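import Mathlib
import Summits.NavierStokesRegularity.NavierStokesRegularity.Theorems.SubOnsagerCeilingKPFluxBudget
import HarnessLib

/-!
# KP networks proper: ENTROPY PRODUCTION of the shell-energy entropies `Σ_m c_m E_m^p`
# (helper file for the crux `SubOnsagerCeiling.ForwardTailCeilingKP`, stmt-NavierStokesRegularity-27057, `--supports`;
# hand leafhand-ns-subonsagerceiling-4 gen 24; def-free; companion of `SubOnsagerCeilingKPFluxBudget` (p ≥ 1 instead of p = 1)
# and the class version of `Theorems/SubOnsagerCeilingKPChainEntropyProduction.lean`)

For a KP network proper `α ∈ E₂(R)` (symmetric, cancelling, ORTHANT, DIAGONAL feed forms) the shell energies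
`E_m = Σ_i ½X_{i,m}²` form a nearest-neighbour flux chain (`kpProper_shellEnergy_identity`, p640757):
`Ė_m = OUT_{m-1} − OUT_m − 2ν(1+ε₀)^{2m} E_m`, `OUT_m = (1+ε₀)^{5m/2} Σ_{i,j} w_{ij} X_{i,m}² X_{j,m+1} ≥ 0`
(`w_{ij} = α i i j (0,0,1) ≥ 0`, receiving amplitudes `≥ 0`).  The registered stubs of the crux
(`stub_primaryGradedLargeRatio` / `stub_primaryGradedSmallRatio`, LEAD skeleton «kp-shell-barrier») are ν-uniform
`θ`-shell barriers, `θ > 1/2`; by `Theorems/SubOnsagerCeilingKPEntropyCeilingTransfer.lean` (hand 4-g10) an `L^p`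
KOLMOGOROV-ENTROPY CEILING `Σ_m β^m E_m(t)^p ≤ C·E₀^p` with `β = (1+ε₀)^{(5/3)(p-1)}`, `p > 5/2`, along every honest
solution IS such a barrier (`θ_p = (5/6)(1 − 1/p)`), for EVERY table at once.  This file lands the exact PRODUCTION LAW
of these sum functionals along the flow, for the whole class and arbitrary shell weights:

* **`kpProper_entropyPartialSum_hasDerivWithinAt`** — for all weights `c : ℕ → ℝ`, powers `p ≥ 1`, depths `N`, within
  `[0,s]`: `d/dt Σ_{m≤N} c_m E_m^p = p Σ_{m<N} OUT_m (c_{m+1} E_{m+1}^{p-1} − c_m E_m^{p-1}) − p c_N E_N^{p-1} OUT_N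
  − p Σ_{m≤N} 2ν(1+ε₀)^{2m} c_m E_m^p` (production at interior bonds + outflow through the top bond + dissipation;
  `p = 1`, `c ≡ 1` is `kpProper_lowEnergy_hasDerivWithinAt`);
* `kpProper_entropyPartialSum_antitoneOn` — sign corollary (`ν ≥ 0`, `1+ε₀ > 0`, shells `≥ 1` non-negative, weights
  `≥ 0`): on a window with NO INVERTED BOND below `N` (`c_{m+1} E_{m+1}^{p-1} ≤ c_m E_m^{p-1}` for all `m < N`, all times)
  the partial entropy is non-increasing — with the entropy weights `c_m = β^m` the production density at bond `m` is
  `OUT_m (W_{m+1}^{p-1} − W_m^{p-1})`, `W_m = ((1+ε₀)^{5/3})^m E_m` the Kolmogorov-weighted shell energy (pure algebra,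
  `Theorems.KPChainEntropy.entropyWeight_production_kolmogorovForm` of the chain companion): entropy is produced ONLY at
  bonds across which the Kolmogorov-weighted energy INCREASES;
* `kpProper_entropyPartialSum_datum` — from a one-shell datum: `Σ_{m≤N} c_m E_m(0)^p = c_0 E₀^p`;
* `kpProper_exists_invertedBond_of_entropyTerm_gt` — the barrier-violation budget in sum currency: if one entropy term
  exceeds the datum entropy, `β^m E_m(t)^p > E₀^p` (`m ≤ N`; i.e. the `θ_p`-barrier with constant `1` fails at `(m,t)`),
  then some bond `n < N` was inverted at some time `τ ≤ t`.

So for every KP network proper the sum-currency route reads: bound the time-integrated inverted-bond production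
`p ∫ Σ_{m<N} OUT_m (W_{m+1}^{p-1} − W_m^{p-1})₊` by the steep-bond destruction + outflow + dissipation + `(C−1)E₀^p`.
NOT proved here: any such bound along actual trajectories (the open dynamics of the stubs).
HONEST FRAMING: statements about Tao-type MODEL lattice ODEs (route SubOnsagerCeiling, rung TL-M2Break); elementary
energy bookkeeping; nothing here bears on Navier–Stokes regularity and no stub, crux or summit is proved.
[cite: Tao2016AveragedNS, §4 (4.2)–(4.3), (4.8)–(4.9), (4.13)] [cite: Kruzkov1970, §3 Thm. 1 (the continuum entropies)]
-/

noncomputable section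

-- the sub-problem namespace `NavierStokesRegularity.NavierStokesRegularity` is the tree's layout (D-0017)
set_option linter.dupNamespace false

namespace Summit.NavierStokesRegularity.NavierStokesRegularity.Theorems

open Set Finset
open scoped Topology
open Literature.Analysis.FluidPDE.TaoCascade

variable {α : Fin 4 → Fin 4 → Fin 4 → ℤ × ℤ × ℤ → ℝ}

/-- Summation by parts for a flux chain (weights `a_m`, bond values `P_m`, `P_{-1} := 0`):
`Σ_{m≤N} a_m (P_{m-1} − P_m) = Σ_{m<N} P_m (a_{m+1} − a_m) − a_N P_N`. [folklore] -/
private theorem kpEntropy_telescope (a P : ℕ → ℝ) (N : ℕ) :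
    ∑ n ∈ range (N + 1), a n * ((if n = 0 then 0 else P (n - 1)) - P n) =
      ∑ n ∈ range N, P n * (a (n + 1) - a n) - a N * P N := by
  induction N with
  | zero => simp
  | succ N ih =>
      rw [Finset.sum_range_succ, ih, Finset.sum_range_succ]
      have h : (if N + 1 = 0 then (0 : ℝ) else P (N + 1 - 1)) = P N := by simp
      rw [h]
      ring

/-- **ENTROPY PRODUCTION LAW OF A KP NETWORK PROPER (arbitrary weights).**  Along a solution of the `ν`-viscous
lattice within `[0,s]` vanishing below shell `0`, for all weights `c : ℕ → ℝ`, every power `p ≥ 1`, every depth `N`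
and every `t ∈ [0,s]`, the partial sum `Σ_{m≤N} c_m E_m^p` (`E_m = Σ_i ½X_{i,m}²`) has within `[0,s]` the derivative
`p Σ_{m<N} OUT_m (c_{m+1} E_{m+1}^{p-1} − c_m E_m^{p-1}) − p c_N E_N^{p-1} OUT_N − p Σ_{m≤N} 2ν(1+ε₀)^{2m} c_m E_m^p`,
`OUT_m = (1+ε₀)^{5m/2} Σ_{i,j} α i i j (0,0,1) X_{i,m}² X_{j,m+1}`. MODEL lattice statement.
[cite: Tao2016AveragedNS, §4 (4.8)–(4.9), (4.13)] -/
theorem kpProper_entropyPartialSum_hasDerivWithinAt (hs : IsSymmetricCoeff α) (hc : IsCancellingCoeff α)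
    (hO : ∀ (Y : Fin 4 → ℤ → ℝ → ℝ) (τ : ℝ), (∀ (j : Fin 4) (k : ℤ), 1 ≤ k → 0 ≤ Y j k τ) →
      ∀ δ : ℝ, 0 < δ → ∀ (i : Fin 4) (n : ℤ), 1 ≤ n → Y i n τ = 0 → 0 ≤ quadTerm δ α Y i n τ)
    (hD : ∀ a b i : Fin 4, a ≠ b → α a b i (0, 0, 1) = 0)
    {ε₀ ν s : ℝ} {X : Fin 4 → ℤ → ℝ → ℝ}
    (hvan : ∀ (i : Fin 4) (k : ℤ), k < 0 → ∀ t : ℝ, X i k t = 0)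
    (hode : ∀ (i : Fin 4) (k : ℤ), ∀ t ∈ Icc (0 : ℝ) s, HasDerivWithinAt (X i k)
      (quadTerm ε₀ α X i k t - ν * (1 + ε₀) ^ ((2 : ℝ) * k) * X i k t) (Icc (0 : ℝ) s) t)
    (c : ℕ → ℝ) {p : ℕ} (hp : 1 ≤ p) (N : ℕ) {t : ℝ} (ht : t ∈ Icc (0 : ℝ) s) :
    HasDerivWithinAt (fun τ => ∑ m ∈ Finset.range (N + 1), c m * (∑ i, (1 / 2 : ℝ) * X i (m : ℤ) τ ^ 2) ^ p)
      ((p : ℝ) * ∑ m ∈ Finset.range N,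
          ((1 + ε₀) ^ ((5 : ℝ) * (m : ℝ) / 2) *
              ∑ i, ∑ j, α i i j (0, 0, 1) * X i (m : ℤ) t ^ 2 * X j ((m : ℤ) + 1) t) *
            (c (m + 1) * (∑ i, (1 / 2 : ℝ) * X i ((m : ℤ) + 1) t ^ 2) ^ (p - 1) -
              c m * (∑ i, (1 / 2 : ℝ) * X i (m : ℤ) t ^ 2) ^ (p - 1)) -
        (p : ℝ) * (c N * (∑ i, (1 / 2 : ℝ) * X i (N : ℤ) t ^ 2) ^ (p - 1)) *
          ((1 + ε₀) ^ ((5 : ℝ) * (N : ℝ) / 2) *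
            ∑ i, ∑ j, α i i j (0, 0, 1) * X i (N : ℤ) t ^ 2 * X j ((N : ℤ) + 1) t) -
        (p : ℝ) * ∑ m ∈ Finset.range (N + 1),
          2 * (ν * (1 + ε₀) ^ ((2 : ℝ) * (m : ℝ))) * (c m * (∑ i, (1 / 2 : ℝ) * X i (m : ℤ) t ^ 2) ^ p))
      (Icc 0 s) t := by
  obtain ⟨q, rfl⟩ : ∃ q, p = q + 1 := ⟨p - 1, by omega⟩
  simp only [Nat.add_sub_cancel]
  -- abbreviations (values at the time `t`)
  set E : ℤ → ℝ := fun k => ∑ i, (1 / 2 : ℝ) * X i k t ^ 2 with hE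
  set IN : ℕ → ℝ := fun m => (1 + ε₀) ^ ((5 : ℝ) * (((m : ℤ) : ℝ) - 1) / 2) *
    ∑ i, ∑ a, α a a i (0, 0, 1) * X a ((m : ℤ) - 1) t ^ 2 * X i (m : ℤ) t with hIN
  set OUT : ℕ → ℝ := fun m => (1 + ε₀) ^ ((5 : ℝ) * (m : ℝ) / 2) *
    ∑ i, ∑ j, α i i j (0, 0, 1) * X i (m : ℤ) t ^ 2 * X j ((m : ℤ) + 1) t with hOUT
  set a : ℕ → ℝ := fun m => ((q + 1 : ℕ) : ℝ) * (c m * E m ^ q) with ha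
  have hflux : ∀ m : ℕ, ∑ i, X i (m : ℤ) t * quadTerm ε₀ α X i (m : ℤ) t = IN m - IN (m + 1) := by
    intro m
    rw [kpProper_shellEnergy_identity hs hc hO hD ε₀ X (m : ℤ) t, kpProper_outFlux_eq_inFlux_succ ε₀ X (m : ℤ) t]
    simp only [hIN]
    push_cast
    simp only [add_sub_cancel_right]
  have hIN0 : IN 0 = 0 := by
    have hz : ∀ a, X a (((0 : ℕ) : ℤ) - 1) t = 0 := fun a => hvan a _ (by norm_num) t
    simp only [hIN, hz]
    simp
  have hINsucc : ∀ m : ℕ, IN (m + 1) = OUT m := by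
    intro m
    simp only [hIN, hOUT]
    push_cast
    simp only [add_sub_cancel_right]
    rw [Finset.sum_comm]
  have hIN_eq : ∀ m : ℕ, IN m = if m = 0 then 0 else OUT (m - 1) := by
    intro m
    rcases Nat.eq_zero_or_pos m with rfl | hm
    · simp [hIN0]
    · obtain ⟨n, rfl⟩ : ∃ n, m = n + 1 := ⟨m - 1, by omega⟩
      rw [if_neg (by omega), Nat.add_sub_cancel, hINsucc]
  -- derivative of one term
  have hterm : ∀ m ∈ Finset.range (N + 1),
      HasDerivWithinAt (fun τ => c m * (∑ i, (1 / 2 : ℝ) * X i (m : ℤ) τ ^ 2) ^ (q + 1))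
        (a m * (IN m - IN (m + 1)) -
          ((q + 1 : ℕ) : ℝ) * (2 * (ν * (1 + ε₀) ^ ((2 : ℝ) * (m : ℝ))) * (c m * E m ^ (q + 1))))
        (Icc 0 s) t := by
    intro m _
    have h1 := forwardSourceSmoothing_hasDerivWithinAt_denergy Finset.univ (m : ℤ) (fun i => hode i (m : ℤ)) ht
    have h2 := (h1.pow (q + 1)).const_mul (c m)
    refine h2.congr_deriv ?_
    rw [hflux m]
    simp only [ha, hE, Nat.add_sub_cancel]
    push_cast
    ring
  have hsum := HasDerivWithinAt.fun_sum (u := Finset.range (N + 1))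
    (A := fun m τ => c m * (∑ i, (1 / 2 : ℝ) * X i (m : ℤ) τ ^ 2) ^ (q + 1))
    (A' := fun m => a m * (IN m - IN (m + 1)) -
      ((q + 1 : ℕ) : ℝ) * (2 * (ν * (1 + ε₀) ^ ((2 : ℝ) * (m : ℝ))) * (c m * E m ^ (q + 1))))
    (x := t) (s := Icc 0 s) hterm
  refine hsum.congr_deriv ?_
  rw [Finset.sum_sub_distrib]
  have htel : ∑ m ∈ Finset.range (N + 1), a m * (IN m - IN (m + 1)) =
      ∑ m ∈ Finset.range N, OUT m * (a (m + 1) - a m) - a N * OUT N := by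
    rw [Finset.sum_congr rfl fun m _ => by rw [hIN_eq m, hINsucc m]]
    exact kpEntropy_telescope a OUT N
  rw [htel]
  have hA : ∑ m ∈ Finset.range N, OUT m * (a (m + 1) - a m) =
      ((q + 1 : ℕ) : ℝ) * ∑ m ∈ Finset.range N,
        OUT m * (c (m + 1) * (∑ i, (1 / 2 : ℝ) * X i ((m : ℤ) + 1) t ^ 2) ^ q -
          c m * (∑ i, (1 / 2 : ℝ) * X i (m : ℤ) t ^ 2) ^ q) := by
    rw [Finset.mul_sum]
    refine Finset.sum_congr rfl fun m _ => ?_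
    have h3 : (((m + 1 : ℕ) : ℤ)) = (m : ℤ) + 1 := by push_cast; ring
    simp only [ha, hE, h3]
    ring
  have hB : a N * OUT N = ((q + 1 : ℕ) : ℝ) * (c N * (∑ i, (1 / 2 : ℝ) * X i (N : ℤ) t ^ 2) ^ q) * OUT N := by
    simp only [ha, hE]
  have hC : ∑ m ∈ Finset.range (N + 1),
      ((q + 1 : ℕ) : ℝ) * (2 * (ν * (1 + ε₀) ^ ((2 : ℝ) * (m : ℝ))) * (c m * E m ^ (q + 1))) =
      ((q + 1 : ℕ) : ℝ) * ∑ m ∈ Finset.range (N + 1),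
        2 * (ν * (1 + ε₀) ^ ((2 : ℝ) * (m : ℝ))) * (c m * (∑ i, (1 / 2 : ℝ) * X i (m : ℤ) t ^ 2) ^ (q + 1)) := by
    rw [Finset.mul_sum]
  rw [hA, hB, hC]

/-- **No inverted bond ⇒ the partial entropy decays** (KP network proper, `ν ≥ 0`, `1 + ε₀ > 0`, shells `≥ 1`
non-negative on `[0,s]`, weights `c_m ≥ 0`): if at every time of the window and every bond `m < N`,
`c_{m+1} E_{m+1}^{p-1} ≤ c_m E_m^{p-1}`, then `Σ_{m≤N} c_m E_m^p` is non-increasing on `[0,s]` (production `≤ 0`,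
outflow `≥ 0` by `kpProper_feed_nonneg`, dissipation `≥ 0`). MODEL lattice statement.
[cite: Tao2016AveragedNS, §4 (4.8)–(4.9), (4.13)] -/
theorem kpProper_entropyPartialSum_antitoneOn (hs : IsSymmetricCoeff α) (hc : IsCancellingCoeff α)
    (hO : ∀ (Y : Fin 4 → ℤ → ℝ → ℝ) (τ : ℝ), (∀ (j : Fin 4) (k : ℤ), 1 ≤ k → 0 ≤ Y j k τ) →
      ∀ δ : ℝ, 0 < δ → ∀ (i : Fin 4) (n : ℤ), 1 ≤ n → Y i n τ = 0 → 0 ≤ quadTerm δ α Y i n τ)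
    (hD : ∀ a b i : Fin 4, a ≠ b → α a b i (0, 0, 1) = 0)
    {ε₀ ν s : ℝ} (hε : 0 < 1 + ε₀) (hν : 0 ≤ ν) {X : Fin 4 → ℤ → ℝ → ℝ}
    (hvan : ∀ (i : Fin 4) (k : ℤ), k < 0 → ∀ t : ℝ, X i k t = 0)
    (hode : ∀ (i : Fin 4) (k : ℤ), ∀ t ∈ Icc (0 : ℝ) s, HasDerivWithinAt (X i k)
      (quadTerm ε₀ α X i k t - ν * (1 + ε₀) ^ ((2 : ℝ) * k) * X i k t) (Icc (0 : ℝ) s) t)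
    (hnn : ∀ t ∈ Icc (0 : ℝ) s, ∀ (i : Fin 4) (k : ℤ), 1 ≤ k → 0 ≤ X i k t)
    {c : ℕ → ℝ} (hcw : ∀ m, 0 ≤ c m) {p : ℕ} (hp : 1 ≤ p) (N : ℕ)
    (hsteep : ∀ t ∈ Icc (0 : ℝ) s, ∀ m < N,
      c (m + 1) * (∑ i, (1 / 2 : ℝ) * X i ((m : ℤ) + 1) t ^ 2) ^ (p - 1) ≤
        c m * (∑ i, (1 / 2 : ℝ) * X i (m : ℤ) t ^ 2) ^ (p - 1)) :
    AntitoneOn (fun τ => ∑ m ∈ Finset.range (N + 1), c m * (∑ i, (1 / 2 : ℝ) * X i (m : ℤ) τ ^ 2) ^ p)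
      (Icc 0 s) := by
  have hderiv := fun t (ht : t ∈ Icc (0 : ℝ) s) =>
    kpProper_entropyPartialSum_hasDerivWithinAt hs hc hO hD hvan hode c hp N ht
  refine antitoneOn_of_deriv_nonpos (convex_Icc 0 s)
    (fun t ht => (hderiv t ht).continuousWithinAt) (fun t ht => ?_) (fun t ht => ?_)
  · rw [interior_Icc] at ht
    exact ((hderiv t (Ioo_subset_Icc_self ht)).hasDerivAt
      (Icc_mem_nhds ht.1 ht.2)).differentiableAt.differentiableWithinAt
  · rw [interior_Icc] at ht
    have ht' : t ∈ Icc (0 : ℝ) s := Ioo_subset_Icc_self ht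
    rw [((hderiv t ht').hasDerivAt (Icc_mem_nhds ht.1 ht.2)).deriv]
    -- the out-fluxes are non-negative
    have hOUT : ∀ m : ℕ, 0 ≤ (1 + ε₀) ^ ((5 : ℝ) * (m : ℝ) / 2) *
        ∑ i, ∑ j, α i i j (0, 0, 1) * X i (m : ℤ) t ^ 2 * X j ((m : ℤ) + 1) t := by
      intro m
      refine mul_nonneg (Real.rpow_pos_of_pos hε _).le (Finset.sum_nonneg fun i _ =>
        Finset.sum_nonneg fun j _ => ?_)
      exact mul_nonneg (mul_nonneg (kpProper_feed_nonneg hO i j) (sq_nonneg _)) (hnn t ht' j _ (by omega))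
    have hEnn : ∀ k : ℤ, 0 ≤ ∑ i, (1 / 2 : ℝ) * X i k t ^ 2 := fun k =>
      Finset.sum_nonneg fun i _ => by positivity
    have hp0 : (0 : ℝ) ≤ (p : ℝ) := Nat.cast_nonneg p
    have h1 : (p : ℝ) * ∑ m ∈ Finset.range N,
        ((1 + ε₀) ^ ((5 : ℝ) * (m : ℝ) / 2) *
            ∑ i, ∑ j, α i i j (0, 0, 1) * X i (m : ℤ) t ^ 2 * X j ((m : ℤ) + 1) t) *
          (c (m + 1) * (∑ i, (1 / 2 : ℝ) * X i ((m : ℤ) + 1) t ^ 2) ^ (p - 1) -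
            c m * (∑ i, (1 / 2 : ℝ) * X i (m : ℤ) t ^ 2) ^ (p - 1)) ≤ 0 := by
      refine mul_nonpos_of_nonneg_of_nonpos hp0 (Finset.sum_nonpos fun m hm => ?_)
      exact mul_nonpos_of_nonneg_of_nonpos (hOUT m) (sub_nonpos.2 (hsteep t ht' m (Finset.mem_range.1 hm)))
    have h2 : 0 ≤ (p : ℝ) * (c N * (∑ i, (1 / 2 : ℝ) * X i (N : ℤ) t ^ 2) ^ (p - 1)) *
        ((1 + ε₀) ^ ((5 : ℝ) * (N : ℝ) / 2) *
          ∑ i, ∑ j, α i i j (0, 0, 1) * X i (N : ℤ) t ^ 2 * X j ((N : ℤ) + 1) t) :=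
      mul_nonneg (mul_nonneg hp0 (mul_nonneg (hcw N) (pow_nonneg (hEnn _) _))) (hOUT N)
    have h3 : 0 ≤ (p : ℝ) * ∑ m ∈ Finset.range (N + 1),
        2 * (ν * (1 + ε₀) ^ ((2 : ℝ) * (m : ℝ))) * (c m * (∑ i, (1 / 2 : ℝ) * X i (m : ℤ) t ^ 2) ^ p) := by
      refine mul_nonneg hp0 (Finset.sum_nonneg fun m _ => ?_)
      exact mul_nonneg (mul_nonneg (by norm_num) (mul_nonneg hν (Real.rpow_pos_of_pos hε _).le))
        (mul_nonneg (hcw m) (pow_nonneg (hEnn _) _))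
    linarith

/-- **Datum value**: from a one-shell datum `X₀` on shell `0`, `Σ_{m≤N} c_m E_m(0)^p = c_0 · E₀^p` (`p ≥ 1`).
[cite: Tao2016AveragedNS, §4 (4.6)–(4.7)] -/
theorem kpProper_entropyPartialSum_datum {X₀ : Fin 4 → ℝ} {X : Fin 4 → ℤ → ℝ → ℝ}
    (hdat : ∀ (i : Fin 4) (k : ℤ), X i k 0 = if k = 0 then X₀ i else 0)
    (c : ℕ → ℝ) {p : ℕ} (hp : 1 ≤ p) (N : ℕ) :
    ∑ m ∈ Finset.range (N + 1), c m * (∑ i, (1 / 2 : ℝ) * X i (m : ℤ) 0 ^ 2) ^ p =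
      c 0 * (∑ i, (1 / 2 : ℝ) * X₀ i ^ 2) ^ p := by
  obtain ⟨q, rfl⟩ : ∃ q, p = q + 1 := ⟨p - 1, by omega⟩
  rw [Finset.sum_eq_single_of_mem 0 (by simp)]
  · simp [hdat]
  · intro m _ hm
    have h : ∀ i, X i (m : ℤ) 0 = 0 := fun i => by rw [hdat]; simp [hm]
    simp [h]

/-- **The barrier-violation budget in sum currency (every KP network proper).**  Entropy weights
`c_m = (((1+ε₀)^{5/3})^{p-1})^m`, `p ≥ 1`: if along an honest non-negative solution from a one-shell datum some entropy
term exceeds the datum entropy, `c_m E_m(t)^p > E₀^p` with `m ≤ N` (the `θ_p`-barrier with constant `1` fails at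
`(m, t)`), then some bond `n < N` was INVERTED (`c_{n+1} E_{n+1}^{p-1} > c_n E_n^{p-1}`) at some time `τ ≤ t`.
MODEL lattice statement. [cite: Tao2016AveragedNS, §4 (4.8)–(4.9), (4.13)] -/
theorem kpProper_exists_invertedBond_of_entropyTerm_gt (hs : IsSymmetricCoeff α) (hc : IsCancellingCoeff α)
    (hO : ∀ (Y : Fin 4 → ℤ → ℝ → ℝ) (τ : ℝ), (∀ (j : Fin 4) (k : ℤ), 1 ≤ k → 0 ≤ Y j k τ) →
      ∀ δ : ℝ, 0 < δ → ∀ (i : Fin 4) (n : ℤ), 1 ≤ n → Y i n τ = 0 → 0 ≤ quadTerm δ α Y i n τ)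
    (hD : ∀ a b i : Fin 4, a ≠ b → α a b i (0, 0, 1) = 0)
    {ε₀ ν s : ℝ} (hε : 0 < 1 + ε₀) (hν : 0 ≤ ν) {X₀ : Fin 4 → ℝ} {X : Fin 4 → ℤ → ℝ → ℝ}
    (hdat : ∀ (i : Fin 4) (k : ℤ), X i k 0 = if k = 0 then X₀ i else 0)
    (hvan : ∀ (i : Fin 4) (k : ℤ), k < 0 → ∀ t : ℝ, X i k t = 0)
    (hode : ∀ (i : Fin 4) (k : ℤ), ∀ t ∈ Icc (0 : ℝ) s, HasDerivWithinAt (X i k)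
      (quadTerm ε₀ α X i k t - ν * (1 + ε₀) ^ ((2 : ℝ) * k) * X i k t) (Icc (0 : ℝ) s) t)
    (hnn : ∀ t ∈ Icc (0 : ℝ) s, ∀ (i : Fin 4) (k : ℤ), 1 ≤ k → 0 ≤ X i k t)
    {p : ℕ} (hp : 1 ≤ p) {N m : ℕ} (hm : m ≤ N) {t : ℝ} (ht : t ∈ Icc (0 : ℝ) s)
    (hviol : (∑ i, (1 / 2 : ℝ) * X₀ i ^ 2) ^ p <
      (((1 + ε₀) ^ ((5 : ℝ) / 3)) ^ (p - 1)) ^ m * (∑ i, (1 / 2 : ℝ) * X i (m : ℤ) t ^ 2) ^ p) :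
    ∃ τ ∈ Icc (0 : ℝ) s, τ ≤ t ∧ ∃ n < N,
      (((1 + ε₀) ^ ((5 : ℝ) / 3)) ^ (p - 1)) ^ n * (∑ i, (1 / 2 : ℝ) * X i (n : ℤ) τ ^ 2) ^ (p - 1) <
        (((1 + ε₀) ^ ((5 : ℝ) / 3)) ^ (p - 1)) ^ (n + 1) *
          (∑ i, (1 / 2 : ℝ) * X i ((n : ℤ) + 1) τ ^ 2) ^ (p - 1) := by
  set c : ℕ → ℝ := fun n => (((1 + ε₀) ^ ((5 : ℝ) / 3)) ^ (p - 1)) ^ n with hcdef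
  have hcw : ∀ n, 0 ≤ c n := fun n => pow_nonneg (pow_nonneg (Real.rpow_pos_of_pos hε _).le _) _
  by_contra hcon
  simp only [not_exists, not_and, not_lt] at hcon
  have hts : t ≤ s := ht.2
  have hode' : ∀ (i : Fin 4) (k : ℤ), ∀ τ ∈ Icc (0 : ℝ) t, HasDerivWithinAt (X i k)
      (quadTerm ε₀ α X i k τ - ν * (1 + ε₀) ^ ((2 : ℝ) * k) * X i k τ) (Icc (0 : ℝ) t) τ :=
    fun i k τ hτ => (hode i k τ ⟨hτ.1, hτ.2.trans hts⟩).mono (Icc_subset_Icc le_rfl hts)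
  have hnn' : ∀ τ ∈ Icc (0 : ℝ) t, ∀ (i : Fin 4) (k : ℤ), 1 ≤ k → 0 ≤ X i k τ :=
    fun τ hτ i k hk => hnn τ ⟨hτ.1, hτ.2.trans hts⟩ i k hk
  have hsteep : ∀ τ ∈ Icc (0 : ℝ) t, ∀ n < N,
      c (n + 1) * (∑ i, (1 / 2 : ℝ) * X i ((n : ℤ) + 1) τ ^ 2) ^ (p - 1) ≤
        c n * (∑ i, (1 / 2 : ℝ) * X i (n : ℤ) τ ^ 2) ^ (p - 1) :=
    fun τ hτ n hn => hcon τ ⟨hτ.1, hτ.2.trans hts⟩ hτ.2 n hn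
  have hanti := kpProper_entropyPartialSum_antitoneOn hs hc hO hD hε hν hvan hode' hnn' hcw hp N hsteep
  have hle : ∑ n ∈ Finset.range (N + 1), c n * (∑ i, (1 / 2 : ℝ) * X i (n : ℤ) t ^ 2) ^ p ≤
      ∑ n ∈ Finset.range (N + 1), c n * (∑ i, (1 / 2 : ℝ) * X i (n : ℤ) 0 ^ 2) ^ p :=
    hanti (left_mem_Icc.2 ht.1) (right_mem_Icc.2 ht.1) ht.1
  have h0 := kpProper_entropyPartialSum_datum hdat c hp N
  have hc0 : c 0 = 1 := by simp [hcdef]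
  have hEnn : ∀ k : ℤ, 0 ≤ ∑ i, (1 / 2 : ℝ) * X i k t ^ 2 := fun k =>
    Finset.sum_nonneg fun i _ => by positivity
  have hterm : c m * (∑ i, (1 / 2 : ℝ) * X i (m : ℤ) t ^ 2) ^ p ≤
      ∑ n ∈ Finset.range (N + 1), c n * (∑ i, (1 / 2 : ℝ) * X i (n : ℤ) t ^ 2) ^ p :=
    Finset.single_le_sum (f := fun n => c n * (∑ i, (1 / 2 : ℝ) * X i (n : ℤ) t ^ 2) ^ p)
      (fun n _ => mul_nonneg (hcw n) (pow_nonneg (hEnn _) _)) (Finset.mem_range.2 (by omega))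
  have : c m * (∑ i, (1 / 2 : ℝ) * X i (m : ℤ) t ^ 2) ^ p ≤ (∑ i, (1 / 2 : ℝ) * X₀ i ^ 2) ^ p := by
    have := hterm.trans hle
    rw [h0, hc0, one_mul] at this
    exact this
  exact absurd hviol (not_lt.2 this)

end Summit.NavierStokesRegularity.NavierStokesRegularity.Theorems

end
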